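import Literature.MathematicalPhysics.QuantumFieldTheory.Balaban1983to89.B13RealSliceEntryLetters
import Mathlib.Analysis.SpecificLimits.Basic

/-!
# `Balaban1983to89.B13RealSliceRateLetters` — T. Bałaban, *Propagators for lattice gauge theories in a background field*, Commun. Math. Phys.
**99** (1985) 389–434 [Balaban1985BackgroundPropagators], Thm 3.4 p. 400 («the extended operators satisfy all the inequalities»); *Renormalization
group approach to lattice gauge field theories. II*, Commun. Math. Phys. **116** (1988) 1–22 [Balaban1988RG2Cluster], (1.33)–(1.34) p. 9; T. Ransford,
*Potential Theory in the Complex Plane* (CUP 1995) Thm 4.3.7 [Ransford1995]: THE TOWER FORM OF THE REAL-SLICE TRANSFER — a TWO-SPACING RATE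
(geometric in the cutoff index, with decay in the lattice distance) known on the REAL configurations of a complex ball of analyticity survives on the
smaller ball with the exponent `1 − λ(r)` (ratio `s ↦ s^{1−λ(r)}`, decay `δ ↦ (1−λ(r))δ`, constant `B ↦ B^{1−λ}M_b^{λ}`), and a CONVERGENT tower's
limit inherits locality and is approached geometrically with decay.

Statement-level complex analysis ([folklore]: the two-constants theorem, summed geometric series) over the tree's `B13RealSliceEntryLetters.decay_of_realSlice`
(itself over `Literature.Analysis.Complex.TwoConstantsDisc.norm_le_two_constants_disc_of_norm_le`) and Mathlib's `dist_le_of_le_geometric_of_tendsto`;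
kernel-checked; nothing of Bałaban's operators is constructed or asserted; no node is discharged; count-neutral.

WHY THIS FILE.  `TwoConstantsDisc`'s docstring names the consumer: «a two-spacing RATE known for REAL background fields passes to the COMPLEX small-field
chart on which Bałaban's renormalisation step reads the earlier terms ([Balaban1988RG2Cluster] (1.33)–(1.34)), at the cost of the exponent `1 − λ(r)`».
`B13RealSliceEntryLetters.decay_of_realSlice` (T-28.2) is the ONE-kernel form (a decay letter); this file adds the TOWER form every η-rate consumer needs —
written generically so that the King-model instances (`Summit….BalabanUVNodesN15KingModelPotentialComplexLetters` parts 32–37, where the pattern was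
first run inline) and the Bałaban-side consumers (NE2 ∕ NE5 rows) cite ONE lemma:
* ★ `rate_of_realSlice` — a family `K k : E → Matrix p n ℂ` (think `K k = C^{(k+1)} − C^{(k)}`), entrywise holomorphic on `‖u‖ < R`, `‖K k u‖ ≤ M_b` there,
  `‖K k v‖_{ij} ≤ B·s^k·e^{−δ d(i,j)}` at the REAL `v` of the ball (`0 ≤ B ≤ M_b`, `0 ≤ s ≤ 1`) ⟹ `‖K k u‖_{ij} ≤ B^{1−λ}M_b^{λ}·(s^{1−λ})^k·e^{−(1−λ)δ d(i,j)}`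
  for `‖u‖ < (r∕(1+r))R`, `λ = λ(r)`, every `0 < r < 1` — the rate survives with ratio `s^{1−λ(r)} < 1` when `s < 1`;
* ★ `limit_of_realSlice_rate` — a tower `F k` with entrywise holomorphic members whose consecutive differences satisfy the hypotheses of `rate_of_realSlice`
  with `s < 1`, converging entrywise to `G` on the small ball ⟹ `‖F k u − G u‖_{ij} ≤ B^{1−λ}M_b^{λ}·e^{−(1−λ)δd(i,j)}·(s^{1−λ})^k∕(1 − s^{1−λ})`;
* `limit_decay_of_realSlice` — the limit of an entrywise convergent family obeying T-28.2's hypotheses is local: `‖G u‖_{ij} ≤ B^{1−λ}M_b^{λ}e^{−(1−λ)δ d(i,j)}`.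

PROVENANCE.  Cell `pub-ymgap` (D-0062 Track A), node N15 (NE2) King-model rung, seat `pub-ymgap-dag-n15-d` g11: the generic content of parts 32 ∕ 33
(`kingCov_twoSpacing_complexRate_geometric`, `kingModel_complexCoupling_package` (c)(e)), lifted to the Literature beside T-28.2 so that it is citable by name.
v1.0.1 (docstring-only; declarations byte-identical): the RG2 locator of (1.33)–(1.34) corrected to print p. 9 (referee ref-J READ-131 NIT-L; p. 15 carries §2's (2.13)–(2.14)).
-/

noncomputable section

namespace Literature.MathematicalPhysics.QuantumFieldTheory.Balaban1983to89.B13RealSliceRateLetters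

open Metric Set Filter Topology
open scoped Matrix
open Literature.MathematicalPhysics.QuantumFieldTheory.Balaban1983to89.B13RealSliceEntryLetters
  (RealStructure lam lam_nonneg lam_lt_one decay_of_realSlice)

variable {E : Type*} [NormedAddCommGroup E] [NormedSpace ℂ E]

/-- `(B·s^k)^{1−λ} = B^{1−λ}·(s^{1−λ})^k` for `B, s ≥ 0` (private helper). [folklore] -/
private theorem mul_pow_rpow_eq {B s : ℝ} (hB : 0 ≤ B) (hs : 0 ≤ s) (t : ℝ) (k : ℕ) :
    (B * s ^ k) ^ t = B ^ t * (s ^ t) ^ k := by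
  rw [Real.mul_rpow hB (pow_nonneg hs k), ← Real.rpow_natCast (s ^ t) k, ← Real.rpow_mul hs, mul_comm t (k : ℝ), Real.rpow_mul hs,
    Real.rpow_natCast]

/-- ★ **THE TOWER FORM OF T-28.2 — A TWO-SPACING RATE AT COMPLEX BACKGROUND FROM THE REAL SLICE.**  Let `K k : E → Matrix p n ℂ` (`k ∈ ℕ`) have
entries holomorphic on the ball `‖u‖ < R` with the rate-free bound `‖K k u‖_{ij} ≤ M_b` there, and on the REAL configurations of the ball the geometric
rate with decay `‖K k v‖_{ij} ≤ B·s^k·e^{−δ d(i,j)}` (`0 ≤ B ≤ M_b`, `0 ≤ s ≤ 1`, `δ ≥ 0`, `d ≥ 0`).  Then for every `0 < r < 1`, every `‖u‖ < (r∕(1+r))R` and all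
`k, i, j`:  `‖K k u‖_{ij} ≤ B^{1−λ(r)}·M_b^{λ(r)}·(s^{1−λ(r)})^k·e^{−(1−λ(r))δ d(i,j)}` — the rate survives with ratio `s^{1−λ(r)}` and decay `(1−λ(r))δ`.
[cite: Ransford1995, Thm. 4.3.7; Balaban1985BackgroundPropagators, Thm 3.4 p.400; Balaban1988RG2Cluster, (1.33)–(1.34) p.9] -/
theorem rate_of_realSlice (ℛ : RealStructure E) {p n : Type} {K : ℕ → E → Matrix p n ℂ} {dm : p → n → ℝ}
    {R B Mb δ s r : ℝ} (hK : ∀ k i j, DifferentiableOn ℂ (fun u => K k u i j) (ball (0 : E) R))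
    (hMb : ∀ k, ∀ u ∈ ball (0 : E) R, ∀ i j, ‖K k u i j‖ ≤ Mb)
    (hB : ∀ k, ∀ v ∈ ℛ.Ereal, ‖v‖ < R → ∀ i j, ‖K k v i j‖ ≤ B * s ^ k * Real.exp (-(δ * dm i j)))
    (hB0 : 0 ≤ B) (hBM : B ≤ Mb) (hs0 : 0 ≤ s) (hs1 : s ≤ 1) (hδ : 0 ≤ δ) (hdist : ∀ i j, 0 ≤ dm i j) (hr0 : 0 < r) (hr1 : r < 1) :
    ∀ u ∈ ball (0 : E) (r / (1 + r) * R), ∀ k i j,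
      ‖K k u i j‖ ≤ B ^ (1 - lam r) * Mb ^ lam r * (s ^ (1 - lam r)) ^ k * Real.exp (-((1 - lam r) * δ * dm i j)) := by
  intro u hu k i j
  have hBk0 : 0 ≤ B * s ^ k := mul_nonneg hB0 (pow_nonneg hs0 k)
  have hBkM : B * s ^ k ≤ Mb := (mul_le_of_le_one_right hB0 (pow_le_one₀ hs0 hs1)).trans hBM
  have key := decay_of_realSlice ℛ (hK k) (hMb k) (hB k) hBk0 hBkM hδ hdist hr0 hr1 u hu i j
  rw [mul_pow_rpow_eq hB0 hs0] at key
  calc ‖K k u i j‖ ≤ B ^ (1 - lam r) * (s ^ (1 - lam r)) ^ k * Mb ^ lam r * Real.exp (-((1 - lam r) * δ * dm i j)) := key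
    _ = _ := by ring

/-- The surviving ratio is `< 1` when `s < 1`. [cite: Ransford1995, Thm. 4.3.7] -/
theorem rpow_ratio_lt_one {s r : ℝ} (hs0 : 0 ≤ s) (hs1 : s < 1) : s ^ (1 - lam r) < 1 :=
  Real.rpow_lt_one hs0 hs1 (by linarith [lam_lt_one r])

/-- ★ **THE LIMIT OF A TOWER IS APPROACHED GEOMETRICALLY AT COMPLEX BACKGROUND, WITH DECAY.**  Let `F k : E → Matrix p n ℂ` have entries holomorphic on
`‖u‖ < R`, and let the consecutive differences `K k := F (k+1) − F k` obey the hypotheses of `rate_of_realSlice` with `s < 1` (bound `M_b` on the ball,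
rate `B·s^k·e^{−δ d}` on the real configurations).  If `F k u i j → G u i j` for every `u` of the small ball `‖u‖ < (r∕(1+r))R`, then there, with
`ϑ := s^{1−λ(r)}`:  `‖F k u − G u‖_{ij} ≤ B^{1−λ}M_b^{λ}·e^{−(1−λ)δ d(i,j)}·ϑ^k∕(1 − ϑ)` (`rate_of_realSlice` summed by Mathlib's
`dist_le_of_le_geometric_of_tendsto`). [cite: Ransford1995, Thm. 4.3.7; Balaban1985BackgroundPropagators, Thm 3.4 p.400] -/
theorem limit_of_realSlice_rate (ℛ : RealStructure E) {p n : Type} {F : ℕ → E → Matrix p n ℂ} {G : E → Matrix p n ℂ} {dm : p → n → ℝ}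
    {R B Mb δ s r : ℝ} (hF : ∀ k i j, DifferentiableOn ℂ (fun u => F k u i j) (ball (0 : E) R))
    (hMb : ∀ k, ∀ u ∈ ball (0 : E) R, ∀ i j, ‖F (k + 1) u i j - F k u i j‖ ≤ Mb)
    (hB : ∀ k, ∀ v ∈ ℛ.Ereal, ‖v‖ < R → ∀ i j, ‖F (k + 1) v i j - F k v i j‖ ≤ B * s ^ k * Real.exp (-(δ * dm i j)))
    (hB0 : 0 ≤ B) (hBM : B ≤ Mb) (hs0 : 0 ≤ s) (hs1 : s < 1) (hδ : 0 ≤ δ) (hdist : ∀ i j, 0 ≤ dm i j) (hr0 : 0 < r) (hr1 : r < 1)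
    (hlim : ∀ u ∈ ball (0 : E) (r / (1 + r) * R), ∀ i j, Tendsto (fun k => F k u i j) atTop (𝓝 (G u i j))) :
    ∀ u ∈ ball (0 : E) (r / (1 + r) * R), ∀ k i j,
      ‖F k u i j - G u i j‖ ≤ B ^ (1 - lam r) * Mb ^ lam r * Real.exp (-((1 - lam r) * δ * dm i j))
        * (s ^ (1 - lam r)) ^ k / (1 - s ^ (1 - lam r)) := by
  intro u hu k i j
  set ϑ : ℝ := s ^ (1 - lam r) with hϑ
  set A : ℝ := B ^ (1 - lam r) * Mb ^ lam r * Real.exp (-((1 - lam r) * δ * dm i j)) with hA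
  have hϑ1 : ϑ < 1 := rpow_ratio_lt_one hs0 hs1
  have hrate := rate_of_realSlice ℛ (K := fun k u => F (k + 1) u - F k u) (dm := dm)
    (fun k i' j' => by
      simp only [Matrix.sub_apply]
      exact (hF (k + 1) i' j').sub (hF k i' j'))
    (fun k u' hu' i' j' => by simpa only [Matrix.sub_apply] using hMb k u' hu' i' j')
    (fun k v hv hvR i' j' => by simpa only [Matrix.sub_apply] using hB k v hv hvR i' j')
    hB0 hBM hs0 hs1.le hδ hdist hr0 hr1 u hu
  have hstep : ∀ m, dist (F m u i j) (F (m + 1) u i j) ≤ A * ϑ ^ m := by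
    intro m
    rw [dist_eq_norm, ← norm_neg, neg_sub]
    have h := hrate m i j
    simp only [Matrix.sub_apply] at h
    calc ‖F (m + 1) u i j - F m u i j‖ ≤ B ^ (1 - lam r) * Mb ^ lam r * ϑ ^ m * Real.exp (-((1 - lam r) * δ * dm i j)) := h
      _ = A * ϑ ^ m := by rw [hA]; ring
  have key := dist_le_of_le_geometric_of_tendsto ϑ A hϑ1 hstep (hlim u hu i j) k
  rwa [dist_eq_norm] at key

/-- **THE LIMIT INHERITS LOCALITY.**  If every member of an entrywise convergent family obeys the hypotheses of T-28.2 (`decay_of_realSlice`: holomorphic on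
`‖u‖ < R`, `≤ M_b` there, `≤ B·e^{−δd}` on the real configurations), its limit `G` satisfies `‖G u‖_{ij} ≤ B^{1−λ}M_b^{λ}·e^{−(1−λ)δ d(i,j)}` on the small ball.
[cite: Ransford1995, Thm. 4.3.7; Balaban1985BackgroundPropagators, Thm 3.4 p.400, (3.108) p.416] -/
theorem limit_decay_of_realSlice (ℛ : RealStructure E) {p n : Type} {F : ℕ → E → Matrix p n ℂ} {G : E → Matrix p n ℂ} {dm : p → n → ℝ}
    {R B Mb δ r : ℝ} (hF : ∀ k i j, DifferentiableOn ℂ (fun u => F k u i j) (ball (0 : E) R))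
    (hMb : ∀ k, ∀ u ∈ ball (0 : E) R, ∀ i j, ‖F k u i j‖ ≤ Mb)
    (hB : ∀ k, ∀ v ∈ ℛ.Ereal, ‖v‖ < R → ∀ i j, ‖F k v i j‖ ≤ B * Real.exp (-(δ * dm i j)))
    (hB0 : 0 ≤ B) (hBM : B ≤ Mb) (hδ : 0 ≤ δ) (hdist : ∀ i j, 0 ≤ dm i j) (hr0 : 0 < r) (hr1 : r < 1)
    (hlim : ∀ u ∈ ball (0 : E) (r / (1 + r) * R), ∀ i j, Tendsto (fun k => F k u i j) atTop (𝓝 (G u i j))) :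
    ∀ u ∈ ball (0 : E) (r / (1 + r) * R), ∀ i j,
      ‖G u i j‖ ≤ B ^ (1 - lam r) * Mb ^ lam r * Real.exp (-((1 - lam r) * δ * dm i j)) := fun u hu i j =>
  le_of_tendsto' (hlim u hu i j).norm fun k => decay_of_realSlice ℛ (hF k) (hMb k) (hB k) hB0 hBM hδ hdist hr0 hr1 u hu i j

end Literature.MathematicalPhysics.QuantumFieldTheory.Balaban1983to89.B13RealSliceRateLetters

end
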